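import Literature.NumberTheory.GaloisRepresentations.CarayolSerreLemmas
import Literature.RepresentationTheory.Semisimple.BurnsideMatrixSpan
import Mathlib.RingTheory.Nakayama
import Mathlib.LinearAlgebra.Matrix.InvariantBasisNumber
import Mathlib.RingTheory.OrzechProperty
import HarnessLib

/-!
# Carayol's theorem: the character determines the representation (proof)

Topic `Literature/NumberTheory/GaloisRepresentations`.  This file DISCHARGES the named fact
`Literature.NumberTheory.GaloisRepresentations.exists_conj_eq_of_trace_eq_of_isAbsIrreducible_residual`
of `CarayolSerreLemmas.lean` — Mazur, *An introduction to the deformation theory of Galois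
representations*, Ch. II §5, Proposition (Carayol [Ca, Thm. 1], Serre [Se 2]): for a local ring
`A`, a group `G` and `ρ ρ' : G → GL_n(A)` with `ρ mod 𝔪_A` absolutely irreducible and
`tr ρ' = tr ρ`, there is `P ∈ GL_n(A)` with `ρ' = P ρ P⁻¹` — by
`exists_conj_eq_of_trace_eq_of_isAbsIrreducible_residual_holds`.

We follow the printed proof [Maz, §5, "taken from [Se 2]"], whose architecture is:

1. `ρ̄'` is absolutely irreducible as well;
2. [Maz, §4 Proposition] absolute irreducibility of `ρ̄` means `A[G] → M_n(A)` is onto (Burnside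
   over the residue field `k`, then Nakayama's lemma);
3. "Goursat's lemma" for the image `Φ ⊆ M_n(A) × M_n(A)` of `A[G]` under `(r, r')`: both
   projections of the subalgebra `Φ` are onto, the traces of the two components agree on `Φ`,
   hence (`x = Trace(X) = Trace(X') = 0`) both projections are injective and `Φ` is the graph of
   an `A`-algebra endomorphism `f` of `M_n(A)` with `f ∘ r = r'`;
4. "any such isomorphism is inner" [Bourbaki, *Algèbre*, Ch. II §5, ex. 2].

Deviations.  (1) is proved here not through semisimplification and the multiplicities
`1 + p·μ` of [C–R, Th. 30.16] but by running step 3 over `k` first: the second projection of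
`Φ̄ ⊆ M_n(k) × M_n(k)` is injective and the first is onto, so `dim_k k⟨ρ̄'(G)⟩ = n²`, i.e.
`k⟨ρ̄'(G)⟩ = M_n(k)` (which is all that step 2 uses of `ρ̄'`).  In (3) the vanishing of the
kernels is read off directly from the non-degeneracy of `(b, x) ↦ tr(bx)` instead of the
classification of two-sided ideals of `M_n(A)`.  (4) is proved for every `A`-algebra
endomorphism `f` of `M_n(A)`, `A` local, `n ≥ 1`: with `e i j = f(E i j)`, some entry `(a, b)` of
the idempotent `e 0 0` is a unit, and `P = (col_b (e i 0))_i` conjugates (`f x · P = P · x`,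
with explicit inverse).  The group ring `A[G]` is replaced throughout by `A`-spans of matrices
(`Literature.RepresentationTheory.Semisimple.span_eq_top_iff_forall_isIrreducible` is Burnside's
theorem in this form).  The hypotheses "Noetherian, complete" of the fact are not used.

## References

* [Maz] B. Mazur, *An introduction to the deformation theory of Galois representations*, in
  Modular Forms and Fermat's Last Theorem (Cornell, Silverman, Stevens, eds.), Springer 1997,
  Ch. II §4 Proposition, §5 Proposition. [cite: Mazur1997Deformation, Ch. II §5 Proposition]
* [Ca] H. Carayol, *Formes modulaires et représentations galoisiennes à valeurs dans un anneau
  local complet*, Contemp. Math. 165 (1994), 213–237, Thm. 1.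
* [Se 2] J.-P. Serre, *Représentations linéaires sur des anneaux locaux (d'après Carayol)*,
  preprint 1995.
* N. Bourbaki, *Algèbre*, Ch. II §5, exercice 2; C. W. Curtis, I. Reiner, *Representation
  theory of finite groups and associative algebras* (1962), (27.4), (30.16).
-/

noncomputable section

open scoped Pointwise
open Matrix IsLocalRing

namespace Literature.NumberTheory.GaloisRepresentations

namespace CarayolSerre

/-! ### Step 4: algebra endomorphisms of `M_n(A)` over a local ring are inner -/

section Inner

variable {A : Type*} [CommRing A]

/-- `x * E_{l0} = ∑ i, x_{il} E_{i0}`: right multiplication by the matrix unit `E_{l0}` moves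
column `l` of `x` to column `0`. [folklore] -/
theorem mul_single_zero_one {m : ℕ} (x : Matrix (Fin (m + 1)) (Fin (m + 1)) A) (l : Fin (m + 1)) :
    x * Matrix.single l (0 : Fin (m + 1)) (1 : A) =
      ∑ i, x i l • Matrix.single i (0 : Fin (m + 1)) (1 : A) := by
  ext p q
  rw [Matrix.sum_apply]
  simp only [Matrix.mul_apply, Matrix.single_apply, Matrix.smul_apply, smul_eq_mul, mul_ite,
    mul_one, mul_zero, ite_and, Finset.sum_ite_eq, Finset.sum_ite_eq', Finset.mem_univ, if_true]

/-- **Every `A`-algebra endomorphism of `M_n(A)` is inner when `A` is local** (the automorphism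
case is [Bourbaki, *Algèbre* II §5, ex. 2], quoted in [Maz, §5]): the images
`e i j = f(E i j)` of the matrix units are matrix units summing to `1`; some entry `(a, b)` of
the idempotent `e 0 0` is a unit (else `1 = ∑ e i 0 * e 0 0 * e 0 i` would have entries in
`𝔪`); then `P = (column b of e i 0)_i` intertwines (`f x * P = P * x`) and has the explicit
left inverse `Q j c = w * e 0 j a c` (`w * e 0 0 a b = 1`). [folklore] -/
theorem exists_units_forall_map_eq_conj [IsLocalRing A] {n : ℕ}
    (f : Matrix (Fin n) (Fin n) A →ₐ[A] Matrix (Fin n) (Fin n) A) :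
    ∃ P : GL (Fin n) A, ∀ x,
      f x = (P : Matrix (Fin n) (Fin n) A) * x * ((P⁻¹ : GL (Fin n) A) : Matrix (Fin n) (Fin n) A) := by
  cases n with
  | zero => exact ⟨1, fun x => Subsingleton.elim _ _⟩
  | succ m =>
  -- the images of the matrix units
  obtain ⟨e, he⟩ : ∃ e : Fin (m + 1) → Fin (m + 1) → Matrix (Fin (m + 1)) (Fin (m + 1)) A,
      ∀ i j, e i j = f (Matrix.single i j 1) := ⟨_, fun _ _ => rfl⟩
  have he_same : ∀ i j l, e i j * e j l = e i l := fun i j l => by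
    rw [he, he, he, ← map_mul, Matrix.single_mul_single_same, mul_one]
  have he_ne : ∀ i j j' l, j ≠ j' → e i j * e j' l = 0 := fun i j j' l h => by
    rw [he, he, ← map_mul, Matrix.single_mul_single_of_ne (1 : A) i j j' h, map_zero]
  have he_sum : ∑ i, e i i = 1 := by
    simp only [he, ← map_sum, Matrix.sum_single_one, map_one]
  -- some entry of the idempotent `e 0 0` is a unit
  obtain ⟨a, b, hu⟩ : ∃ a b, IsUnit (e 0 0 a b) := by
    by_contra! hcon
    have hmem : ∀ i c d, e i i c d ∈ maximalIdeal A := by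
      intro i c d
      rw [← he_same i 0 i, ← he_same i 0 0, Matrix.mul_apply]
      refine Submodule.sum_mem _ fun y _ => ?_
      rw [Matrix.mul_apply, Finset.sum_mul]
      refine Submodule.sum_mem _ fun x _ => Ideal.mul_mem_right _ _ (Ideal.mul_mem_left _ _ ?_)
      exact (IsLocalRing.mem_maximalIdeal _).2 (mem_nonunits_iff.2 (hcon x y))
    have h1 : (1 : A) ∈ maximalIdeal A := by
      have h := congrFun (congrFun he_sum 0) 0
      rw [Matrix.sum_apply, Matrix.one_apply_eq] at h
      rw [← h]
      exact Submodule.sum_mem _ fun i _ => hmem i 0 0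
    exact (maximalIdeal.isMaximal A).ne_top ((Ideal.eq_top_iff_one _).2 h1)
  obtain ⟨w, hw⟩ := hu.exists_left_inv
  -- the intertwiner `P` (column `i` = column `b` of `e i 0`) and its inverse `Q`
  obtain ⟨P, hP⟩ : ∃ P : Matrix (Fin (m + 1)) (Fin (m + 1)) A, ∀ c i, P c i = e i 0 c b :=
    ⟨Matrix.of fun c i => e i 0 c b, fun _ _ => rfl⟩
  obtain ⟨Q, hQ⟩ : ∃ Q : Matrix (Fin (m + 1)) (Fin (m + 1)) A, ∀ j c, Q j c = w * e 0 j a c :=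
    ⟨Matrix.of fun j c => w * e 0 j a c, fun _ _ => rfl⟩
  have hQP : Q * P = 1 := by
    ext j i
    have hsum : ∑ c, e 0 j a c * e i 0 c b = (e 0 j * e i 0) a b := (Matrix.mul_apply).symm
    rw [Matrix.mul_apply, Matrix.one_apply]
    simp only [hP, hQ, mul_assoc]
    rw [← Finset.mul_sum, hsum]
    by_cases hji : j = i
    · subst hji
      rw [he_same, if_pos rfl, hw]
    · rw [he_ne _ _ _ _ hji, Matrix.zero_apply, mul_zero, if_neg hji]
  have hPQ : P * Q = 1 := mul_eq_one_comm.mp hQP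
  refine ⟨⟨P, Q, hPQ, hQP⟩, fun x => ?_⟩
  -- `f x * P = P * x`
  have hint : f x * P = P * x := by
    ext c l
    have hl : ∑ d, f x c d * e l 0 d b = (f x * e l 0) c b := (Matrix.mul_apply).symm
    have hfx : f x * e l 0 = ∑ i, x i l • e i 0 := by
      simp only [he]
      rw [← map_mul, mul_single_zero_one, map_sum]
      exact Finset.sum_congr rfl fun i _ => map_smul f _ _
    rw [Matrix.mul_apply, Matrix.mul_apply]
    simp only [hP]
    rw [hl, hfx, Matrix.sum_apply]
    simp only [Matrix.smul_apply, smul_eq_mul]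
    exact Finset.sum_congr rfl fun i _ => mul_comm _ _
  show f x = P * x * Q
  rw [← hint, mul_assoc, hPQ, mul_one]

end Inner

/-! ### Step 3: Goursat's lemma with traces -/

section Goursat

variable {R : Type*} [CommRing R] {n : ℕ}

/-- Non-degeneracy of the trace pairing on `M_n(R)`: if `tr (b x) = 0` for all `b` then `x = 0`
(test against the matrix units `b = E_{ji}`). [folklore] -/
theorem eq_zero_of_forall_trace_mul_eq_zero (x : Matrix (Fin n) (Fin n) R)
    (h : ∀ b : Matrix (Fin n) (Fin n) R, (b * x).trace = 0) : x = 0 := by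
  ext i j
  have hij := h (Matrix.single j i 1)
  rwa [Matrix.trace_single_mul, smul_eq_mul, one_mul] at hij

/-- **Goursat–Serre, with traces** [Maz, §5, proof of the Proposition]: let
`S ⊆ M_n(R) × M_n(R)` be an `R`-submodule closed under multiplication on which the traces of the
two components agree, and whose FIRST projection is onto.  Then the SECOND projection is
injective on `S`: if `(x, 0) ∈ S` then, choosing `(b, b') ∈ S` over any `b`,
`tr(b x) = tr(b' 0) = 0`, so `x = 0`.  (Mazur: "`x = Trace(X) = Trace(X') = 0`, i.e., the ideal
`I` vanishes".) [cite: Mazur1997Deformation, Ch. II §5, proof of the Proposition] -/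
theorem fst_eq_zero_of_snd_eq_zero
    {S : Submodule R (Matrix (Fin n) (Fin n) R × Matrix (Fin n) (Fin n) R)}
    (hmul : ∀ z ∈ S, ∀ w ∈ S, z * w ∈ S) (htr : ∀ z ∈ S, z.1.trace = z.2.trace)
    (h1 : ∀ b, ∃ b', (b, b') ∈ S) {z : Matrix (Fin n) (Fin n) R × Matrix (Fin n) (Fin n) R}
    (hz : z ∈ S) (hz2 : z.2 = 0) : z.1 = 0 := by
  refine eq_zero_of_forall_trace_mul_eq_zero _ fun b => ?_
  obtain ⟨b', hb'⟩ := h1 b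
  have h := htr _ (hmul _ hb' _ hz)
  rwa [Prod.fst_mul, Prod.snd_mul, hz2, mul_zero, Matrix.trace_zero] at h

/-- The symmetric half of Goursat–Serre: if the SECOND projection of `S` is onto, the FIRST is
injective on `S`. [cite: Mazur1997Deformation, Ch. II §5, proof of the Proposition] -/
theorem snd_eq_zero_of_fst_eq_zero
    {S : Submodule R (Matrix (Fin n) (Fin n) R × Matrix (Fin n) (Fin n) R)}
    (hmul : ∀ z ∈ S, ∀ w ∈ S, z * w ∈ S) (htr : ∀ z ∈ S, z.1.trace = z.2.trace)
    (h2 : ∀ b', ∃ b, (b, b') ∈ S) {z : Matrix (Fin n) (Fin n) R × Matrix (Fin n) (Fin n) R}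
    (hz : z ∈ S) (hz1 : z.1 = 0) : z.2 = 0 := by
  refine eq_zero_of_forall_trace_mul_eq_zero _ fun b' => ?_
  obtain ⟨b, hb⟩ := h2 b'
  have h := htr _ (hmul _ hb _ hz)
  rw [Prod.fst_mul, Prod.snd_mul, hz1, mul_zero, Matrix.trace_zero] at h
  exact h.symm

/-! #### The image `Φ` of `R[G]` under `(ρ, ρ')`, as an `R`-span -/

variable {G : Type*} [Group G] (ρ ρ' : G →* GL (Fin n) R)

/-- `Φ = R⟨(ρ g, ρ' g)⟩` is closed under multiplication (it is the image of the group ring).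
[folklore] -/
theorem mul_mem_span_pair {z w : Matrix (Fin n) (Fin n) R × Matrix (Fin n) (Fin n) R}
    (hz : z ∈ Submodule.span R (Set.range fun g => ((ρ g).val, (ρ' g).val)))
    (hw : w ∈ Submodule.span R (Set.range fun g => ((ρ g).val, (ρ' g).val))) :
    z * w ∈ Submodule.span R (Set.range fun g => ((ρ g).val, (ρ' g).val)) := by
  have hsub : (Set.range fun g => ((ρ g).val, (ρ' g).val)) *
      (Set.range fun g => ((ρ g).val, (ρ' g).val)) ⊆
        Set.range fun g => ((ρ g).val, (ρ' g).val) := by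
    rintro _ ⟨_, ⟨g, rfl⟩, _, ⟨h, rfl⟩, rfl⟩
    exact ⟨g * h, by simp only [map_mul, Units.val_mul, Prod.mk_mul_mk]⟩
  have hzw := Submodule.mul_mem_mul hz hw
  rw [Submodule.span_mul_span] at hzw
  exact Submodule.span_mono hsub hzw

/-- On `Φ` the traces of the two components agree, if `tr ρ' = tr ρ` on `G`. [folklore] -/
theorem trace_fst_eq_trace_snd_of_mem_span_pair
    (htr : ∀ g, (ρ' g).val.trace = (ρ g).val.trace)
    {z : Matrix (Fin n) (Fin n) R × Matrix (Fin n) (Fin n) R}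
    (hz : z ∈ Submodule.span R (Set.range fun g => ((ρ g).val, (ρ' g).val))) :
    z.1.trace = z.2.trace := by
  induction hz using Submodule.span_induction with
  | mem x hx =>
    obtain ⟨g, rfl⟩ := hx
    exact (htr g).symm
  | zero => simp
  | add x y _ _ hx hy => rw [Prod.fst_add, Prod.snd_add, Matrix.trace_add, Matrix.trace_add, hx, hy]
  | smul a x _ hx => rw [Prod.smul_fst, Prod.smul_snd, Matrix.trace_smul, Matrix.trace_smul, hx]

/-- The first projection of `Φ` is `R⟨ρ(G)⟩`. [folklore] -/
theorem map_fst_span_pair :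
    Submodule.map (LinearMap.fst R _ _) (Submodule.span R (Set.range fun g => ((ρ g).val, (ρ' g).val))) =
      Submodule.span R (Set.range fun g => (ρ g).val) := by
  rw [Submodule.map_span, ← Set.range_comp]
  rfl

/-- The second projection of `Φ` is `R⟨ρ'(G)⟩`. [folklore] -/
theorem map_snd_span_pair :
    Submodule.map (LinearMap.snd R _ _) (Submodule.span R (Set.range fun g => ((ρ g).val, (ρ' g).val))) =
      Submodule.span R (Set.range fun g => (ρ' g).val) := by
  rw [Submodule.map_span, ← Set.range_comp]
  rfl

/-- If `R⟨ρ(G)⟩ = M_n(R)`, the first projection of `Φ` is onto. [folklore] -/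
theorem exists_mk_mem_span_pair (h : Submodule.span R (Set.range fun g => (ρ g).val) = ⊤)
    (b : Matrix (Fin n) (Fin n) R) :
    ∃ b', (b, b') ∈ Submodule.span R (Set.range fun g => ((ρ g).val, (ρ' g).val)) := by
  have hb : b ∈ Submodule.map (LinearMap.fst R _ _)
      (Submodule.span R (Set.range fun g => ((ρ g).val, (ρ' g).val))) := by
    rw [map_fst_span_pair, h]
    exact Submodule.mem_top
  obtain ⟨z, hz, rfl⟩ := hb
  exact ⟨z.2, hz⟩

/-- If `R⟨ρ'(G)⟩ = M_n(R)`, the second projection of `Φ` is onto. [folklore] -/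
theorem exists_mk_mem_span_pair' (h : Submodule.span R (Set.range fun g => (ρ' g).val) = ⊤)
    (b' : Matrix (Fin n) (Fin n) R) :
    ∃ b, (b, b') ∈ Submodule.span R (Set.range fun g => ((ρ g).val, (ρ' g).val)) := by
  have hb : b' ∈ Submodule.map (LinearMap.snd R _ _)
      (Submodule.span R (Set.range fun g => ((ρ g).val, (ρ' g).val))) := by
    rw [map_snd_span_pair, h]
    exact Submodule.mem_top
  obtain ⟨z, hz, rfl⟩ := hb
  exact ⟨z.1, hz⟩

/-- **Step 3 of [Maz, §5]**: if `tr ρ' = tr ρ` and both `R⟨ρ(G)⟩` and `R⟨ρ'(G)⟩` are all of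
`M_n(R)`, then `Φ` is the graph of an `R`-algebra endomorphism `f` of `M_n(R)` with
`f (ρ g) = ρ' g` ("`Φ` is in fact the graph of an actual isomorphism of `A`-algebras
`f : M_N(A) → M_N(A)` … by construction, we have `f ∘ r = r'`").
[cite: Mazur1997Deformation, Ch. II §5, proof of the Proposition] -/
theorem exists_algHom_map_eq (htr : ∀ g, (ρ' g).val.trace = (ρ g).val.trace)
    (h : Submodule.span R (Set.range fun g => (ρ g).val) = ⊤)
    (h' : Submodule.span R (Set.range fun g => (ρ' g).val) = ⊤) :
    ∃ f : Matrix (Fin n) (Fin n) R →ₐ[R] Matrix (Fin n) (Fin n) R, ∀ g, f (ρ g).val = (ρ' g).val := by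
  set S := Submodule.span R (Set.range fun g => ((ρ g).val, (ρ' g).val)) with hS
  have hmul : ∀ z ∈ S, ∀ w ∈ S, z * w ∈ S := fun z hz w hw => mul_mem_span_pair ρ ρ' hz hw
  have htrS : ∀ z ∈ S, z.1.trace = z.2.trace := fun z hz =>
    trace_fst_eq_trace_snd_of_mem_span_pair ρ ρ' htr hz
  have h1 : ∀ b, ∃ b', (b, b') ∈ S := exists_mk_mem_span_pair ρ ρ' h
  have h2 : ∀ b', ∃ b, (b, b') ∈ S := exists_mk_mem_span_pair' ρ ρ' h'
  have huniq : ∀ {x y y' : Matrix (Fin n) (Fin n) R}, (x, y) ∈ S → (x, y') ∈ S → y = y' := by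
    intro x y y' hy hy'
    have hzero := snd_eq_zero_of_fst_eq_zero hmul htrS h2 (S.sub_mem hy hy')
      (by rw [Prod.fst_sub, sub_self])
    rwa [Prod.snd_sub, sub_eq_zero] at hzero
  choose F hF using h1
  have hgen : ∀ g, ((ρ g).val, (ρ' g).val) ∈ S := fun g => Submodule.subset_span ⟨g, rfl⟩
  have hone : ((1, 1) : Matrix (Fin n) (Fin n) R × Matrix (Fin n) (Fin n) R) ∈ S := by
    simpa only [map_one, Units.val_one] using hgen 1
  refine ⟨{ toFun := F
            map_one' := huniq (hF 1) hone
            map_mul' := fun x y => huniq (hF _) ?_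
            map_zero' := huniq (hF 0) (by simpa only [Prod.mk_zero_zero] using S.zero_mem)
            map_add' := fun x y => huniq (hF _) ?_
            commutes' := fun r => ?_ }, fun g => huniq (hF _) (hgen g)⟩
  · simpa only [Prod.mk_mul_mk] using hmul _ (hF x) _ (hF y)
  · simpa only [Prod.mk_add_mk] using S.add_mem (hF x) (hF y)
  · rw [Algebra.algebraMap_eq_smul_one]
    exact huniq (hF _) (by simpa only [Prod.smul_mk] using S.smul_mem r hone)

end Goursat

/-! ### Step 1: `k⟨ρ̄'(G)⟩ = M_n(k)` too (dimension count over the residue field) -/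

section Field

variable {k : Type*} [Field k] {n : ℕ} {G : Type*} [Group G]

/-- **Step 1 of [Maz, §5], in span form**: over a field `k`, if the `σ(g)` span `M_n(k)` and
`tr σ' = tr σ` on `G`, then the `σ'(g)` span `M_n(k)` as well.  Indeed the second projection of
`Φ = k⟨(σ g, σ' g)⟩` is injective (`fst_eq_zero_of_snd_eq_zero`) with image `k⟨σ'(G)⟩`, and the
first is onto `M_n(k)`, so `n² ≤ dim Φ = dim k⟨σ'(G)⟩ ≤ n²`.  (Mazur proves instead
`σ'ˢˢ ≅ σ` by [C–R, Th. 30.16]; only this consequence is used.) [folklore] -/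
theorem span_eq_top_of_span_eq_top_of_trace_eq (σ σ' : G →* GL (Fin n) k)
    (htr : ∀ g, (σ' g).val.trace = (σ g).val.trace)
    (h : Submodule.span k (Set.range fun g => (σ g).val) = ⊤) :
    Submodule.span k (Set.range fun g => (σ' g).val) = ⊤ := by
  set S := Submodule.span k (Set.range fun g => ((σ g).val, (σ' g).val)) with hS
  have hmul : ∀ z ∈ S, ∀ w ∈ S, z * w ∈ S := fun z hz w hw => mul_mem_span_pair σ σ' hz hw
  have htrS : ∀ z ∈ S, z.1.trace = z.2.trace := fun z hz =>
    trace_fst_eq_trace_snd_of_mem_span_pair σ σ' htr hz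
  have h1 : ∀ b, ∃ b', (b, b') ∈ S := exists_mk_mem_span_pair σ σ' h
  -- the second projection is injective on `S`
  set f₂ : S →ₗ[k] Matrix (Fin n) (Fin n) k := (LinearMap.snd k _ _).comp S.subtype with hf₂
  have hinj : Function.Injective f₂ := by
    rw [← LinearMap.ker_eq_bot, LinearMap.ker_eq_bot']
    intro z hz
    have hz2 : z.1.2 = 0 := hz
    have hz1 : z.1.1 = 0 := fst_eq_zero_of_snd_eq_zero hmul htrS h1 z.2 hz2
    exact Subtype.ext (Prod.ext hz1 hz2)
  have hrange : LinearMap.range f₂ = Submodule.span k (Set.range fun g => (σ' g).val) := by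
    rw [hf₂, LinearMap.range_comp, Submodule.range_subtype, map_snd_span_pair]
  -- dimension count
  refine Submodule.eq_top_of_finrank_eq (le_antisymm (Submodule.finrank_le _) ?_)
  calc Module.finrank k (Matrix (Fin n) (Fin n) k)
      = Module.finrank k (Submodule.map (LinearMap.fst k _ _) S) := by
        rw [map_fst_span_pair, h, finrank_top]
    _ ≤ Module.finrank k S := Submodule.finrank_map_le _ _
    _ = Module.finrank k (LinearMap.range f₂) := (LinearMap.finrank_range_of_inj hinj).symm
    _ = Module.finrank k (Submodule.span k (Set.range fun g => (σ' g).val)) := by rw [hrange]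

end Field

/-! ### Step 2: Nakayama — `k⟨ρ̄(G)⟩ = M_n(k)` implies `A⟨ρ(G)⟩ = M_n(A)` -/

section Nakayama

variable {A : Type*} [CommRing A] [IsLocalRing A] {n : ℕ}

/-- **[Maz, §4 Proposition], the Nakayama step**: for a local ring `A` with residue field `k` and
any family of matrices `X i ∈ M_n(A)`, if the reductions `X̄ i` span `M_n(k)` over `k` then the
`X i` span `M_n(A)` over `A` ("It follows for general coefficient-rings `A` from Nakayama's
Lemma applied to … `Image(r) ⊂ M_N(A) → M_N(k)`"): `A⟨X⟩ + 𝔪 M_n(A) = M_n(A)` and `M_n(A)` is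
finitely generated. [cite: Mazur1997Deformation, Ch. II §4, Proposition] -/
theorem span_eq_top_of_span_map_residue_eq_top {ι : Type*} (X : ι → Matrix (Fin n) (Fin n) A)
    (h : Submodule.span (ResidueField A) (Set.range fun i => (X i).map (residue A)) = ⊤) :
    Submodule.span A (Set.range X) = ⊤ := by
  refine top_le_iff.mp (Submodule.le_of_le_smul_of_le_jacobson_bot Module.Finite.fg_top
    (maximalIdeal_le_jacobson _) ?_)
  rintro x -
  -- reduction of matrices mod `𝔪`, an `A`-linear map
  set red : Matrix (Fin n) (Fin n) A →ₗ[A] Matrix (Fin n) (Fin n) (ResidueField A) :=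
    (Algebra.linearMap A (ResidueField A)).mapMatrix with hred_def
  have hred : ∀ y : Matrix (Fin n) (Fin n) A, red y = y.map (residue A) := fun y => rfl
  have hA : Submodule.span A (Set.range fun i => (X i).map (residue A)) =
      Submodule.map red (Submodule.span A (Set.range X)) := by
    rw [Submodule.map_span, ← Set.range_comp]
    rfl
  have hx : red x ∈ Submodule.map red (Submodule.span A (Set.range X)) := by
    rw [← hA, ← Submodule.restrictScalars_span A (ResidueField A) IsLocalRing.residue_surjective,
      h]
    exact Submodule.mem_top
  obtain ⟨s, hs, hsx⟩ := hx
  have hent : ∀ i j, (x - s) i j ∈ maximalIdeal A := fun i j => by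
    have hij := congrFun (congrFun hsx i) j
    rw [hred, hred, Matrix.map_apply, Matrix.map_apply] at hij
    rw [Matrix.sub_apply, ← IsLocalRing.residue_eq_zero_iff, map_sub, hij, sub_self]
  have hker : x - s ∈ maximalIdeal A • (⊤ : Submodule A (Matrix (Fin n) (Fin n) A)) := by
    rw [Matrix.matrix_eq_sum_single (x - s)]
    refine Submodule.sum_mem _ fun i _ => Submodule.sum_mem _ fun j _ => ?_
    have hsingle : Matrix.single i j ((x - s) i j) = (x - s) i j • Matrix.single i j (1 : A) := by
      rw [Matrix.smul_single, smul_eq_mul, mul_one]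
    rw [hsingle]
    exact Submodule.smul_mem_smul (hent i j) Submodule.mem_top
  exact Submodule.mem_sup.2 ⟨s, hs, x - s, hker, add_sub_cancel s x⟩

end Nakayama

end CarayolSerre

/-! ### The theorem -/

/-- **Carayol's theorem holds** (discharge of the named fact
`exists_conj_eq_of_trace_eq_of_isAbsIrreducible_residual`): for a (complete Noetherian) local
ring `A`, a group `G` and `ρ ρ' : G → GL_n(A)` with `ρ mod 𝔪_A` absolutely irreducible and
`tr ρ' = tr ρ`, `ρ' = P ρ P⁻¹` for some `P ∈ GL_n(A)`.  Mazur, Ch. II §5 Proposition ("Let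
`ρ' : Π → GL_N(A)` be a representation with the same character as `ρ` … Then `ρ'` and `ρ` are
equivalent representations"), proof after Serre: Burnside over `k` for `ρ̄`
(`Literature.RepresentationTheory.Semisimple.span_eq_top_iff_forall_isIrreducible`), the same
spanning for `ρ̄'` (`CarayolSerre.span_eq_top_of_span_eq_top_of_trace_eq`), Nakayama
(`CarayolSerre.span_eq_top_of_span_map_residue_eq_top`), Goursat with traces
(`CarayolSerre.exists_algHom_map_eq`), and innerness of algebra endomorphisms of `M_n(A)`
(`CarayolSerre.exists_units_forall_map_eq_conj`).  Rank `0` is trivial.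
[cite: Mazur1997Deformation, Ch. II §5 Proposition] -/
theorem exists_conj_eq_of_trace_eq_of_isAbsIrreducible_residual_holds :
    exists_conj_eq_of_trace_eq_of_isAbsIrreducible_residual := by
  intro A _ _ _ _ G _ n ρ ρ' hirr htr
  rcases Nat.eq_zero_or_pos n with rfl | hn
  · exact ⟨1, fun g => Subsingleton.elim _ _⟩
  -- Step 1 for `ρ̄`: Burnside over the residue field
  have hA : Submodule.span (ResidueField A) (Set.range fun g =>
      ((Matrix.GeneralLinearGroup.map (residue A)).comp ρ g).val) = ⊤ :=
    (Literature.RepresentationTheory.Semisimple.span_eq_top_iff_forall_isIrreducible hn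
      ((Matrix.GeneralLinearGroup.map (residue A)).comp ρ)).2 hirr
  -- the characters of `ρ̄'` and `ρ̄` agree
  have htr' : ∀ g, ((Matrix.GeneralLinearGroup.map (residue A)).comp ρ' g).val.trace =
      ((Matrix.GeneralLinearGroup.map (residue A)).comp ρ g).val.trace := fun g => by
    have h := congrArg (residue A) (htr g)
    rw [AddMonoidHom.map_trace, AddMonoidHom.map_trace] at h
    exact h
  -- Step 1 for `ρ̄'`
  have hB := CarayolSerre.span_eq_top_of_span_eq_top_of_trace_eq _ _ htr' hA
  -- Step 2: Nakayama
  have hC : Submodule.span A (Set.range fun g => (ρ g).val) = ⊤ :=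
    CarayolSerre.span_eq_top_of_span_map_residue_eq_top (fun g => (ρ g).val) hA
  have hC' : Submodule.span A (Set.range fun g => (ρ' g).val) = ⊤ :=
    CarayolSerre.span_eq_top_of_span_map_residue_eq_top (fun g => (ρ' g).val) hB
  -- Step 3: Goursat
  obtain ⟨f, hf⟩ := CarayolSerre.exists_algHom_map_eq ρ ρ' htr hC hC'
  -- Step 4: `f` is inner
  obtain ⟨P, hP⟩ := CarayolSerre.exists_units_forall_map_eq_conj f
  exact ⟨P, fun g => Units.ext (by rw [Units.val_mul, Units.val_mul, ← hf, hP])⟩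

end Literature.NumberTheory.GaloisRepresentations
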